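import Summits.BirchSwinnertonDyer.BirchSwinnertonDyer.Theorems.PrintCFramBottomClassIndexLawFiveLeBorelDescentClaimA
import HarnessLib

/-!
# Route `PrintCFram`, crux C2 `BottomClassIndexLawFiveLe` (stmt-BirchSwinnertonDyer-20372), line
# `eisenstein-resource-bdp-line` (registry v18), Kolyvagin lane (serves Stub B = B1 ∧ B2′ through END STATE v16
# `pair ⟹ B`): **KOLYVAGIN'S ORDER TELESCOPE UNDER A DEFECTIVE ČEBOTAREV AXIOM, I — THE CHAIN AND THE LEDGER
# `Σ Nᵢ ≤ M₀ + K·(Δ1+Δ(−1))`** — McCallum's Cassels–Tate induction (Thm. 5.4 "≤"; the tree's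
# `KolyvaginDescent.HypothesesM.sum_expo_le_M₀_of_casselsTate`) re-proved in the explicit currency of
# `…BorelDescentClaimA/B` with Prop. 3.1 (kernel form) REPLACED by a kernel form WITH A DEFECT BY SIGN
# (cell `bsd-print-cfram`, seat `bsd-line-cfram-p1-w2` g8; helper `--supports` 20372; 0 defs, 0 facts, 0 sorry)

HONEST FRAMING. Nothing about BSD is proved here and nothing of any stub; this is pure algebra, the ORDER-language
counterpart of w2 g7's exponent-language files `…BorelDescentClaimA/ClaimB/Annihilation` (p659508/p659886/p660248),
which obtain `p^{2M₀+1}·Sel ⊆ ℤx` at the Borel (CM-ramified) prime. The crux needs Kolyvagin's bound on the ORDER of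
`Ш` (McCallum 1991 §1 Theorem, `ord_p #Ш(E/K) ≤ 2M₀`), i.e. the Cassels–Tate telescope of Thm. 5.4, which the tree
proves abstractly (`…HeegnerPointsKolyvaginPrimaryOrderTelescopeProofs`): for alternating `τ`-eigen-lifts
`s₁,…,s_K ∈ Sel` (`τ sᵢ = ε(−1)ⁱ sᵢ`), `x`-independent and pairwise isotropic for a bi-additive `P` on `Sel` (the
lifts of the generators of a maximal isotropic `D = ⊕ Dᵢ` of `Ш_{p^∞}`), GIVEN McCallum's Prop. 4.7/Lemma 5.3 in
order language (`hCTV`) and Prop. 3.1 in KERNEL form (`hCeb`: at a Kolyvagin prime above any bound,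
`⟨g₁, g₂, T⟩ ∩ ker loc_λ = ⟨T⟩`), one has `Σᵢ expo sᵢ ≤ M₀`, whence `#Ш_{p^∞} = (#D)² ≤ p^{2M₀}`.

At the Borel prime the kernel form is FALSE as stated: a class of sign `−η_line` and odd `𝓞`-depth `e` has order
`p^{(e+1)/2}` but local order `≤ p^{(e−1)/2}` at EVERY Kolyvagin prime (w2 g6 `…BorelKolyvaginBlind`; w2 g7 FILE 7′
`…BorelRequestsCebotarev`, requests by sign). What survives is a kernel form WITH DEFECT: with `Δ ν ∈ ℕ` the defect
allowed on classes of sign `ν` (Borel: `Δ η_line = 0`, `Δ (−η_line) = 1`), at a Kolyvagin prime above any bound one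
can ask `T ⊆ ker loc_λ` and, on each of the two lines `ℤg₁`, `ℤg₂` (signs `ν`, `−ν`),
`p^i g ∈ ker loc_λ ⟹ p^{i+Δ(sign g)} g ∈ ⟨T⟩` — hypothesis `hCebΔ`; file II (`…BorelOrderTelescopeBridge`) shows it
follows line by line from a REQUEST of order `ord(g*)/p^Δ` on any representative `g* ∈ g + ⟨T⟩` jointly with `T ↦ 0`,
the shape FILE 7′ delivers for top-independent families (the H¹-side discharge = FILE 7′ + a top-layer reduction of
the later lifts; companion note `Lines/eisenstein-resource-bdp-line-w2g8-notes.md`; not done here).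

WHAT IS PROVED (hypotheses explicit, names/shapes as in `…BorelDescentClaimA`; `expo` an exact-exponent function,
`p^a v = 0 ↔ expo v ≤ a`; `D := Δ 1 + Δ (−1)`):
* `exists_chain_of_casselsTate_defect` — McCallum's chain `n_k = ℓ₁⋯ℓ_k`, the later lifts vanishing at the primes of
  `n_k`, with the invariant **(I_Δ)** `p^i c(n_k) ∈ ⟨s_j : j > k⟩ ⟹ (M − M₀) + Σ_{j≤k} expo s_j ≤ i + k·D` (the
  tree's (I) with a budget of `D` per step: at step `k+1` the faithfulness of `loc_λ` on `c(n_k)` may be short by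
  `Δ(−ν)` and the visibility of `s_{k+1}` by `Δ ν`, `ν = ε(−1)^{k+1}`); `hCTV` is displayed at an auxiliary level
  `M₁ ≥ M₀ + K·D` so that the classes `p^i c(n)` it is applied to stay in its range (`M − M₁ ≤ i`).
* (file II `…BorelOrderTelescopeBridge`) `sum_expo_le_M₀_add_of_casselsTate_defect` — at `k = K`, `p^M c(n_K) = 0`
  gives **`Σ_{i≤K} expo sᵢ ≤ M₀ + K·D`**: the tree's theorem verbatim for `Δ ≡ 0`; under the Borel rule (`D = 1`)
  `Σ Nᵢ ≤ M₀ + K`, i.e. `ord_p #Ш(W/K″)[p^∞] ≤ 2M₀ + 2K` for the lifts of `D = ⊕_{i≤K} Dᵢ` — one `p` of slack per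
  step of the alternating chain, McCallum's `2M₀` verbatim whenever each step's `(−η)`-member (the lift `s_{k+1}` at
  odd steps, the Kolyvagin class `c(n_k)` at even steps, on the visible model `η = ε`) is faithfully localised — by
  FILE 7′, whenever its `T`-reduced representative has EVEN depth (w2 g7's one-parity residue, now per step).
THEOREMS ONLY; no definition, no named fact, no `sorry`. BSD is not proved by any of this; no summit statement is
proved by this seat. References: [McCallumLMS1991] §1 Theorem, §3 Prop. 3.1/Cor. 3.2, §4 Prop. 4.4, Prop. 4.7,
§5 Lemma 5.3, Thm. 5.4 (proof, (16)–(23)), Cor. 5.6; [GrossLMS1991] §10.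
-/

set_option autoImplicit false
-- `…BirchSwinnertonDyer.BirchSwinnertonDyer.Theorems…` is the problem's mandated namespace (D-0017).
set_option linter.dupNamespace false

noncomputable section

open scoped Classical

namespace Summit.BirchSwinnertonDyer.BirchSwinnertonDyer.Theorems.PrintCFram.BorelDescent

open Literature.NumberTheory.EllipticCurves Literature.NumberTheory.EllipticCurves.KolyvaginDescent
  Summit.BirchSwinnertonDyer.BirchSwinnertonDyer.Theorems.SylvesterTwoUpper.DescentDefect

/-! ## §0 Algebraic preliminaries: exact exponents, spans of finitely many lifts, isotropy along a span

(Re-proved here because the corresponding lemmas of `…PrimaryOrderTelescopeProofs` are private to that file and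
phrased over `HypothesesM`.) -/

section Prelim

variable {V : Type*} [AddCommGroup V] {p M : ℕ} {expo : V → ℕ}

/-- `p^{expo v} v = 0` for an exact-exponent function (`p^a v = 0 ↔ expo v ≤ a`). [folklore] -/
theorem pow_expo_zsmul_eq_zero (hexpo : ∀ (v : V) (a : ℕ), ((p : ℤ) ^ a) • v = 0 ↔ expo v ≤ a) (v : V) :
    ((p : ℤ) ^ expo v) • v = 0 :=
  (hexpo v _).2 le_rfl

/-- `p^a v ≠ 0` for `a < expo v`. [folklore] -/
theorem pow_zsmul_ne_zero_of_lt_expo (hexpo : ∀ (v : V) (a : ℕ), ((p : ℤ) ^ a) • v = 0 ↔ expo v ≤ a)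
    {v : V} {a : ℕ} (ha : a < expo v) : ((p : ℤ) ^ a) • v ≠ 0 := fun h ↦
  absurd ((hexpo v a).1 h) (not_le.2 ha)

/-- An element of the subgroup generated by `{s i : i ∈ I}` is a `ℤ`-combination of the `s i`.
[folklore] (adapted from `Literature/…/HeegnerPointsKolyvaginPrimaryOrderTelescopeProofs`) -/
private theorem exists_sum_of_mem_closure_image (s : ℕ → V) (I : Finset ℕ) {v : V}
    (hv : v ∈ AddSubgroup.closure ((I.image s : Finset V) : Set V)) :
    ∃ a : ℕ → ℤ, v = ∑ i ∈ I, a i • s i := by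
  induction hv using AddSubgroup.closure_induction with
  | mem w hw =>
    rw [Finset.coe_image, Set.mem_image] at hw
    obtain ⟨i, hi, rfl⟩ := hw
    rw [Finset.mem_coe] at hi
    refine ⟨fun j ↦ if j = i then 1 else 0, ?_⟩
    simp only [ite_smul, one_smul, zero_smul, Finset.sum_ite_eq', hi, if_true]
  | zero => exact ⟨0, by simp⟩
  | add w w' _ _ hw hw' =>
    obtain ⟨a, rfl⟩ := hw
    obtain ⟨a', rfl⟩ := hw'
    exact ⟨a + a', by simp only [Pi.add_apply, add_smul, Finset.sum_add_distrib]⟩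
  | neg w _ hw =>
    obtain ⟨a, rfl⟩ := hw
    exact ⟨-a, by simp only [Pi.neg_apply, neg_smul, Finset.sum_neg_distrib]⟩

/-- Independence of `x, s₁, …, s_K` as a flag condition: `a s_k ∈ ⟨s_j : k < j ≤ K⟩ ⟹ a s_k = 0`.
[folklore] (adapted from `…PrimaryOrderTelescopeProofs`) -/
private theorem zsmul_eq_zero_of_mem_closure_Ioc {x : V} {K : ℕ} {s : ℕ → V}
    (hind : ∀ (b : ℤ) (a : ℕ → ℤ), b • x + ∑ i ∈ Finset.Ioc 0 K, a i • s i = 0 →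
      b • x = 0 ∧ ∀ i ∈ Finset.Ioc 0 K, a i • s i = 0)
    {k : ℕ} (hk : k ∈ Finset.Ioc 0 K) {a : ℤ}
    (h : a • s k ∈ AddSubgroup.closure (((Finset.Ioc k K).image s : Finset V) : Set V)) :
    a • s k = 0 := by
  obtain ⟨c, hc⟩ := exists_sum_of_mem_closure_image s _ h
  have hkk : k ∉ Finset.Ioc k K := by simp
  have hsub : Finset.Ioc 0 K ∩ Finset.Ioc k K = Finset.Ioc k K := by
    apply Finset.inter_eq_right.mpr
    intro i hi
    simp only [Finset.mem_Ioc] at hi hk ⊢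
    omega
  set a' : ℕ → ℤ := fun i ↦ (if i = k then a else 0) + (if i ∈ Finset.Ioc k K then -c i else 0)
    with ha'
  have hrel : (0 : ℤ) • x + ∑ i ∈ Finset.Ioc 0 K, a' i • s i = 0 := by
    have h1 : ∀ i, a' i • s i =
        (if i = k then a • s i else 0) + (if i ∈ Finset.Ioc k K then (-c i) • s i else 0) := by
      intro i
      simp only [ha', add_smul, ite_smul, zero_smul]
    simp only [zero_smul, zero_add, h1, Finset.sum_add_distrib, Finset.sum_ite_eq', hk, if_true,
      Finset.sum_ite_mem, hsub, neg_smul, Finset.sum_neg_distrib, ← hc, add_neg_cancel]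
  have := (hind 0 a' hrel).2 k hk
  simpa [ha', hkk] using this

/-- Independence of `x, s₁, …, s_K` as a flag condition at `x`: `b x ∈ ⟨s_j : 0 < j ≤ K⟩ ⟹ b x = 0`.
[folklore] (adapted from `…PrimaryOrderTelescopeProofs`) -/
private theorem zsmul_x_eq_zero_of_mem_closure_Ioc {x : V} {K : ℕ} {s : ℕ → V}
    (hind : ∀ (b : ℤ) (a : ℕ → ℤ), b • x + ∑ i ∈ Finset.Ioc 0 K, a i • s i = 0 →
      b • x = 0 ∧ ∀ i ∈ Finset.Ioc 0 K, a i • s i = 0)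
    {b : ℤ} (h : b • x ∈ AddSubgroup.closure (((Finset.Ioc 0 K).image s : Finset V) : Set V)) :
    b • x = 0 := by
  obtain ⟨c, hc⟩ := exists_sum_of_mem_closure_image s _ h
  have hrel : b • x + ∑ i ∈ Finset.Ioc 0 K, (-c i) • s i = 0 := by
    simp only [neg_smul, Finset.sum_neg_distrib, ← hc, add_neg_cancel]
  exact (hind b (fun i ↦ -c i) hrel).1

/-- If `t` pairs to zero with every member of `T ⊆ Sel`, it pairs to zero with `⟨T⟩`. [folklore]
(adapted from `…PrimaryOrderTelescopeProofs`) -/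
private theorem pairing_eq_zero_of_mem_closure {Sel : AddSubgroup V} {R : Type*} [AddCommGroup R]
    (P : Sel →+ Sel →+ R) {T : Set V} (hT : T ⊆ Sel) {t : V} (ht : t ∈ Sel)
    (h0 : ∀ w, ∀ hw : w ∈ T, P ⟨w, hT hw⟩ ⟨t, ht⟩ = 0)
    {w : V} (hw : w ∈ AddSubgroup.closure T) (hwS : w ∈ Sel) :
    P ⟨w, hwS⟩ ⟨t, ht⟩ = 0 := by
  have hle : AddSubgroup.closure T ≤ Sel := (AddSubgroup.closure_le _).mpr hT
  revert hwS
  induction hw using AddSubgroup.closure_induction with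
  | mem w h => exact fun _ ↦ h0 w h
  | zero => exact fun h ↦ by rw [show (⟨0, h⟩ : Sel) = 0 from rfl, map_zero, AddMonoidHom.zero_apply]
  | add w w' hw hw' ih ih' =>
    intro h
    have : (⟨w + w', h⟩ : Sel) = ⟨w, hle hw⟩ + ⟨w', hle hw'⟩ := rfl
    rw [this, map_add, AddMonoidHom.add_apply, ih (hle hw), ih' (hle hw'), add_zero]
  | neg w hw ih =>
    intro h
    rw [show (⟨-w, h⟩ : Sel) = -⟨w, hle hw⟩ from rfl, map_neg, AddMonoidHom.neg_apply, ih (hle hw),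
      neg_zero]

/-- `ℓ n` is a square-free product of Kolyvagin primes for such an `n` and a Kolyvagin prime `ℓ ∤ n`. [folklore] -/
private theorem kolSupp_mul_of_not_dvd' {Kol : ℕ → Prop} (hKol : ∀ ℓ, Kol ℓ → ℓ.Prime) {ℓ n : ℕ}
    (hℓ : Kol ℓ) (hn : KolSupp Kol n) (hℓn : ¬ ℓ ∣ n) : KolSupp Kol (ℓ * n) := by
  have hℓp := hKol ℓ hℓ
  refine ⟨?_, fun q hq ↦ ?_⟩
  · rw [Nat.squarefree_mul_iff]
    exact ⟨(Nat.Prime.coprime_iff_not_dvd hℓp).mpr hℓn, hℓp.squarefree, hn.1⟩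
  · rw [Nat.primeFactors_mul hℓp.ne_zero hn.1.ne_zero, Finset.mem_union, hℓp.primeFactors,
      Finset.mem_singleton] at hq
    rcases hq with rfl | hq
    · exact hℓ
    · exact hn.2 q hq

/-- `ℓ n` has one more prime factor than `n` (`ℓ ∤ n`). [folklore] -/
private theorem card_primeFactors_mul_of_not_dvd' {ℓ n : ℕ} (hℓ : ℓ.Prime) (hn : n ≠ 0) (hℓn : ¬ ℓ ∣ n) :
    (ℓ * n).primeFactors.card = n.primeFactors.card + 1 := by
  rw [Nat.primeFactors_mul hℓ.ne_zero hn, hℓ.primeFactors, ← Finset.insert_eq,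
    Finset.card_insert_of_notMem fun h ↦ hℓn (Nat.dvd_of_mem_primeFactors h)]

/-- The signs `ε(−1)^i` are `±1`. [folklore] -/
private theorem sign_pow_cases' {ε : ℤ} (hε : ε = 1 ∨ ε = -1) (i : ℕ) :
    ε * (-1) ^ i = 1 ∨ ε * (-1) ^ i = -1 := by
  rcases hε with h | h <;> rcases neg_one_pow_eq_or ℤ i with h' | h' <;> simp [h, h']

/-- The defect budget of one step: `Δ ν + Δ (−ν) = Δ 1 + Δ (−1)` for a sign `ν`. [folklore] -/
private theorem defect_add_eq {Δ : ℤ → ℕ} {ν : ℤ} (hν : ν = 1 ∨ ν = -1) :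
    Δ ν + Δ (-ν) = Δ 1 + Δ (-1) := by
  rcases hν with rfl | rfl
  · rfl
  · rw [neg_neg, add_comm]

end Prelim

/-! ## §1 The Cassels–Tate telescope with a defective kernel-form Čebotarev -/

section Telescope

variable {V : Type*} [AddCommGroup V] {Pl : Type*}
variable {p M M₀ M₁ : ℕ} {ε : ℤ} {τ : V →+ V} {Sel : AddSubgroup V} {Loc : Pl → AddSubgroup V}
  {Kol : ℕ → Prop} {pl : ℕ → Pl} {A : ℕ → AddSubgroup V} {x : V} {c : ℕ → V}
  {expo : V → ℕ} {Δ : ℤ → ℕ}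

/-- **McCallum 1991, proof of Thm. 5.4 — the chain `n_k = ℓ₁⋯ℓ_k`, with the invariant (I) carrying a defect
budget.** Data (displayed, shapes of `KolyvaginDescent.HypothesesM` / `…BorelDescentClaimA`): `V` killed by `p^M`,
`expo` an exact-exponent function, Kolyvagin primes `Kol`, the Selmer group `Sel` cut out by `Loc`, the strict
conditions `A ℓ`, `x` of order `p^M`, Kolyvagin's classes `c` with `c 1 = p^{M₀} x`, their signs `τ_c` and Prop. 4.4
(`hc44`); a bi-additive `P` on `Sel` with McCallum's Cassels–Tate value in order language at the auxiliary level
`M₁` (`hCTV`: Prop. 4.7 + Lemma 5.3 + Prop. 4.4); and the DEFECTIVE kernel-form Čebotarev `hCebΔ` (at a Kolyvagin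
prime above any bound killing the eigenclasses `T`: `p^i g ∈ A ℓ ⟹ p^{i+Δ(sign g)} g ∈ ⟨T⟩` on the two lines
`ℤg₁`, `ℤg₂` of opposite signs). For alternating eigen-lifts `s₁,…,s_K ∈ Sel` (`τ sᵢ = ε(−1)ⁱ sᵢ`), pairwise
`P`-isotropic, independent together with `x`, with `expo sᵢ + M₁ ≤ M` and `M₀ + K·(Δ1+Δ(−1)) ≤ M₁`: for every
`k ≤ K` there is `n = n_k` (square-free product of `k` Kolyvagin primes) such that the later lifts `s_j`, `j > k`,
lie in `A q` at every prime `q ∣ n` (McCallum (19)/(23)) and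
**(I_Δ)** `p^i c(n) ∈ ⟨s_j : k < j ≤ K⟩ ⟹ (M − M₀) + Σ_{j≤k} expo s_j ≤ i + k·(Δ1+Δ(−1))`.
[cite: McCallumLMS1991, Thm. 5.4 (proof, (16)–(23)), Prop. 4.7, Lemma 5.3, Prop. 3.1] -/
theorem exists_chain_of_casselsTate_defect (hp : p.Prime) (hε : ε = 1 ∨ ε = -1)
    (htor : ∀ v : V, ((p : ℤ) ^ M) • v = 0)
    (hexpo : ∀ (v : V) (a : ℕ), ((p : ℤ) ^ a) • v = 0 ↔ expo v ≤ a)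
    (hKol : ∀ ℓ, Kol ℓ → ℓ.Prime) (hSel : ∀ s, s ∈ Sel ↔ ∀ v, s ∈ Loc v)
    (hxord : ((p : ℤ) ^ (M - 1)) • x ≠ 0) (hc1 : c 1 = ((p : ℤ) ^ M₀) • x)
    (hτc : ∀ n, KolSupp Kol n → τ (c n) = (ε * (-1) ^ n.primeFactors.card) • c n)
    (hc44 : ∀ ℓ m, Kol ℓ → KolSupp Kol (ℓ * m) → ∀ a : ℕ,
      (((p : ℤ) ^ a) • c (ℓ * m) ∈ Loc (pl ℓ)) ↔ ((p : ℤ) ^ a) • c m ∈ A ℓ)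
    {R : Type*} [AddCommGroup R] (P : Sel →+ Sel →+ R)
    (hCTV : ∀ ℓ m : ℕ, Kol ℓ → KolSupp Kol (ℓ * m) → ¬ ℓ ∣ m →
      ∀ (j N a b : ℕ) (t : V) (ht : t ∈ Sel) (hz : ((p : ℤ) ^ j) • c (ℓ * m) ∈ Sel),
      ((p : ℤ) ^ N) • t = 0 → τ t = (ε * (-1) ^ (ℓ * m).primeFactors.card) • t →
      (∀ q ∈ m.primeFactors, t ∈ A q) → M - M₁ ≤ j → N + M₁ ≤ M → N ≤ j → a + b + 1 = N →
      ((p : ℤ) ^ (a + (j - N))) • c m ∉ A ℓ → ((p : ℤ) ^ b) • t ∉ A ℓ →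
      P ⟨_, hz⟩ ⟨t, ht⟩ ≠ 0)
    (hCebΔ : ∀ (T : Finset V) (g₁ g₂ : V) (ν : ℤ), (ν = 1 ∨ ν = -1) → τ g₁ = ν • g₁ →
      τ g₂ = (-ν) • g₂ → (∀ t ∈ T, ∃ e : ℤ, (e = 1 ∨ e = -1) ∧ τ t = e • t) → ∀ b : ℕ,
      ∃ ℓ, b < ℓ ∧ Kol ℓ ∧ (∀ t ∈ T, t ∈ A ℓ) ∧
        (∀ i : ℕ, ((p : ℤ) ^ i) • g₁ ∈ A ℓ →
          ((p : ℤ) ^ (i + Δ ν)) • g₁ ∈ AddSubgroup.closure (T : Set V)) ∧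
        (∀ i : ℕ, ((p : ℤ) ^ i) • g₂ ∈ A ℓ →
          ((p : ℤ) ^ (i + Δ (-ν))) • g₂ ∈ AddSubgroup.closure (T : Set V)))
    (K : ℕ) (s : ℕ → V) (hsel : ∀ i, s i ∈ Sel)
    (hτs : ∀ i ∈ Finset.Ioc 0 K, τ (s i) = (ε * (-1) ^ i) • s i)
    (hiso : ∀ i ∈ Finset.Ioc 0 K, ∀ i' ∈ Finset.Ioc 0 K, P ⟨s i, hsel i⟩ ⟨s i', hsel i'⟩ = 0)
    (hind : ∀ (b : ℤ) (a : ℕ → ℤ), b • x + ∑ i ∈ Finset.Ioc 0 K, a i • s i = 0 →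
      b • x = 0 ∧ ∀ i ∈ Finset.Ioc 0 K, a i • s i = 0)
    (hM₁ : M₀ + K * (Δ 1 + Δ (-1)) ≤ M₁) (hroom : ∀ i ∈ Finset.Ioc 0 K, expo (s i) + M₁ ≤ M)
    (k : ℕ) (hk : k ≤ K) :
    ∃ n, KolSupp Kol n ∧ n.primeFactors.card = k ∧
      (∀ q ∈ n.primeFactors, ∀ i ∈ Finset.Ioc k K, s i ∈ A q) ∧
      ∀ i : ℕ, ((p : ℤ) ^ i) • c n ∈
          AddSubgroup.closure (((Finset.Ioc k K).image s : Finset V) : Set V) →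
        (M - M₀) + ∑ j ∈ Finset.Ioc 0 k, expo (s j) ≤ i + k * (Δ 1 + Δ (-1)) := by
  set D : ℕ := Δ 1 + Δ (-1) with hD
  -- the pools `⟨s_j : k < j ≤ K⟩` lie in `Sel`
  have hpool : ∀ k, (((Finset.Ioc k K).image s : Finset V) : Set V) ⊆ Sel := by
    intro k v hv
    rw [Finset.coe_image, Set.mem_image] at hv
    obtain ⟨i, -, rfl⟩ := hv
    exact hsel i
  induction k with
  | zero =>
    refine ⟨1, kolSupp_one _, by simp, by simp, fun i hi ↦ ?_⟩
    rw [hc1, smul_smul, ← pow_add] at hi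
    have h0 := zsmul_x_eq_zero_of_mem_closure_Ioc hind hi
    rw [zsmul_eq_zero_iff_prime_pow_dvd hp (htor x) hxord, ← Nat.cast_pow, ← Nat.cast_pow,
      Int.natCast_dvd_natCast, Nat.pow_dvd_pow_iff_le_right hp.one_lt] at h0
    simp only [Finset.Ioc_self, Finset.sum_empty, add_zero, zero_mul]
    omega
  | succ k ih =>
    obtain ⟨n, hn, hcard, hA, hI⟩ := ih (by omega)
    have hn0 : n ≠ 0 := hn.1.ne_zero
    have hk1 : k + 1 ∈ Finset.Ioc 0 K := by simp only [Finset.mem_Ioc]; omega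
    have hk1' : k + 1 ∈ Finset.Ioc k K := by simp only [Finset.mem_Ioc]; omega
    -- signs: `s_{k+1} ∈ V^{ν}`, `c(n_k) ∈ V^{-ν}`, `ν = ε (-1)^{k+1}`
    set ν : ℤ := ε * (-1) ^ (k + 1) with hν
    have hν1 : ν = 1 ∨ ν = -1 := sign_pow_cases' hε (k + 1)
    have hΔν : Δ ν + Δ (-ν) = D := defect_add_eq hν1
    have hτs' : τ (s (k + 1)) = ν • s (k + 1) := hτs (k + 1) hk1
    have hτcn : τ (c n) = (-ν) • c n := by
      rw [hτc n hn, hcard, hν, pow_succ]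
      congr 1
      ring
    set T : Finset V := (Finset.Ioc (k + 1) K).image s with hT
    have hTτ : ∀ t ∈ T, ∃ e : ℤ, (e = 1 ∨ e = -1) ∧ τ t = e • t := by
      intro t ht
      rw [hT, Finset.mem_image] at ht
      obtain ⟨i, hi, rfl⟩ := ht
      refine ⟨_, sign_pow_cases' hε i, hτs i ?_⟩
      simp only [Finset.mem_Ioc] at hi ⊢
      omega
    -- the sub-pool `⟨T⟩ ≤ ⟨s_j : k < j⟩`
    have hTsub : (T : Set V) ⊆ (((Finset.Ioc k K).image s : Finset V) : Set V) := by
      rw [hT, Finset.coe_image, Finset.coe_image]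
      apply Set.image_mono
      intro i hi
      simp only [Finset.coe_Ioc, Set.mem_Ioc] at hi ⊢
      omega
    -- ### the Kolyvagin prime `ℓ = ℓ_{k+1}` (McCallum (21)–(23), defective form)
    obtain ⟨ℓ, hℓn, hℓ, hTA, hF1, hF2⟩ := hCebΔ T (s (k + 1)) (c n) ν hν1 hτs' hτcn hTτ n
    have hℓp := hKol ℓ hℓ
    have hndvd : ¬ ℓ ∣ n := fun h ↦ by
      have := Nat.le_of_dvd (Nat.pos_of_ne_zero hn0) h
      omega
    have hsupp : KolSupp Kol (ℓ * n) := kolSupp_mul_of_not_dvd' hKol hℓ hn hndvd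
    have hcard' : (ℓ * n).primeFactors.card = k + 1 := by
      rw [card_primeFactors_mul_of_not_dvd' hℓp hn0 hndvd, hcard]
    -- Fact B (defective): `p^{i'} c(n)_λ = 0 ⟹ (M - M₀) + ∑_{j ≤ k} N_j ≤ i' + Δ(-ν) + k D`
    have hB : ∀ i' : ℕ, ((p : ℤ) ^ i') • c n ∈ A ℓ →
        (M - M₀) + ∑ j ∈ Finset.Ioc 0 k, expo (s j) ≤ i' + Δ (-ν) + k * D := fun i' hi' ↦
      hI _ (AddSubgroup.closure_mono hTsub (hF2 i' hi'))
    refine ⟨ℓ * n, hsupp, hcard', fun q hq i hi ↦ ?_, fun i hi ↦ ?_⟩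
    · -- (19)/(23): the later lifts vanish at the primes of `ℓ n`
      rw [Nat.primeFactors_mul hℓp.ne_zero hn0, Finset.mem_union, hℓp.primeFactors,
        Finset.mem_singleton] at hq
      rcases hq with rfl | hq
      · apply hTA
        rw [hT, Finset.mem_image]
        exact ⟨i, by simpa using hi, rfl⟩
      · refine hA q hq i ?_
        simp only [Finset.mem_Ioc] at hi ⊢
        omega
    · -- ### the invariant (I_Δ) at `k + 1`
      rw [Finset.sum_Ioc_succ_top (Nat.zero_le k), ← add_assoc]
      have hSel' : ((p : ℤ) ^ i) • c (ℓ * n) ∈ Sel :=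
        (AddSubgroup.closure_le _).mpr ((hT ▸ hpool (k + 1))) hi
      have hAℓ : ((p : ℤ) ^ i) • c n ∈ A ℓ :=
        (hc44 ℓ n hℓ hsupp i).mp ((hSel _).mp hSel' (pl ℓ))
      have hB0 := hB i hAℓ
      set N : ℕ := expo (s (k + 1)) with hNdef
      by_cases hN : N ≤ Δ ν
      · -- the lift is (possibly) invisible: the whole step is paid from the budget
        have : (k + 1) * D = k * D + (Δ ν + Δ (-ν)) := by rw [hΔν]; ring
        omega
      push Not at hN
      by_contra hlt
      push Not at hlt
      have hKD : (k + 1) * D ≤ K * D := Nat.mul_le_mul_right _ (by omega)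
      have hroom' := hroom (k + 1) hk1
      have hNi : N ≤ i := by
        have : (k + 1) * D = k * D + (Δ ν + Δ (-ν)) := by rw [hΔν]; ring
        omega
      have hMi : M - M₁ ≤ i := by
        have : (k + 1) * D = k * D + (Δ ν + Δ (-ν)) := by rw [hΔν]; ring
        omega
      -- (21), defective: `p^{Δν + (i - N)} c(n)_λ ≠ 0`
      have hnot : ((p : ℤ) ^ (Δ ν + (i - N))) • c n ∉ A ℓ := by
        intro h
        have h1 := hB _ h
        have : (k + 1) * D = k * D + (Δ ν + Δ (-ν)) := by rw [hΔν]; ring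
        omega
      -- (22), defective: `s_{k+1}` has order at least `ord / p^{Δν}` at `λ`
      have hsfull : ((p : ℤ) ^ (N - 1 - Δ ν)) • s (k + 1) ∉ A ℓ := by
        intro h
        have hT' := hF1 _ h
        rw [show N - 1 - Δ ν + Δ ν = N - 1 by omega] at hT'
        exact pow_zsmul_ne_zero_of_lt_expo hexpo (show N - 1 < expo (s (k + 1)) by omega)
          (zsmul_eq_zero_of_mem_closure_Ioc hind hk1 (hT ▸ hT'))
      have hτsk : τ (s (k + 1)) = (ε * (-1) ^ (ℓ * n).primeFactors.card) • s (k + 1) := by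
        rw [hcard']
        exact hτs'
      have hAq : ∀ q ∈ n.primeFactors, s (k + 1) ∈ A q := fun q hq ↦ hA q hq (k + 1) hk1'
      have hne := hCTV ℓ n hℓ hsupp hndvd i N (Δ ν) (N - 1 - Δ ν)
        (s (k + 1)) (hsel _) hSel' (pow_expo_zsmul_eq_zero hexpo _) hτsk hAq hMi hroom' hNi
        (by omega) hnot hsfull
      -- isotropy of `⟨T⟩ ∋ p^i c(n_{k+1})` with `s_{k+1}`
      refine hne (pairing_eq_zero_of_mem_closure P (hT ▸ hpool (k + 1)) (hsel (k + 1))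
        (fun w hw ↦ ?_) hi hSel')
      rw [hT, Finset.coe_image, Set.mem_image] at hw
      obtain ⟨i', hi', rfl⟩ := hw
      refine hiso i' ?_ (k + 1) hk1
      simp only [Finset.coe_Ioc, Set.mem_Ioc, Finset.mem_Ioc] at hi' ⊢
      omega

end Telescope

end Summit.BirchSwinnertonDyer.BirchSwinnertonDyer.Theorems.PrintCFram.BorelDescent

end
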